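import Literature.AlgebraicGeometry.Motives.HodgeThetaSubalgebraReductive
import Literature.AlgebraicGeometry.Motives.ZarhinHodgeGroupPositivity
import Literature.Algebra.Lie.CentralRadicalOfCompletelyReducible
import Mathlib.Analysis.InnerProductSpace.PiL2
import HarnessLib

/-!
# The derived algebra of the Hodge Lie algebra is SEMISIMPLE; abelian ideals of `Lie Hg` are central (Deligne LNM 900 I Prop. 3.6 — «`Hg` is reductive», Lie form, completed)

Family `hodge`, layer `Literature/AlgebraicGeometry/Motives` (abstract polarizable `ℚ`-Hodge structures; no geometry).
Cell `pub-hodgecm2` (COR-CM), seat `b27` (count-neutral own lane MT-REDUCTIVE); UNCONDITIONAL, theorems only (no definition,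
no named fact, D-0026); no step towards a summit statement. Sequel of `HodgeThetaSubalgebraReductive` (`𝔥 = 𝔷 ⊕ 𝔡`
with `𝔷 = 𝔥 ∩ End_Hdg(V)`, `𝔡 = [𝔥, 𝔥]` perfect, centre-free) and of `ZarhinHodgeGroupPositivity` (`𝔥_ℂ` is closed
under the Hodge-form adjoint `Y ↦ Y^*`); the Lie step is `Literature/Algebra/Lie/CentralRadicalOfCompletelyReducible`
(Lie's theorem: a Lie algebra with a faithful completely reducible representation has central radical).

PRINTED RESULT. P. Deligne, *Hodge cycles on abelian varieties*, LNM 900 (1982), I Prop. 3.6 (held, re-ed. p. 25):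
«Let `(V, h)` be a polarizable rational Hodge structure; then `MT(V, h)` is reductive» — proof: `ad C` is a Cartan
involution and the Hodge form `ψ(x, C ȳ)` is positive definite, so every `MT`-stable subspace of `V_ℂ` has a stable
complement; a connected group with a faithful completely reducible representation is reductive. B. Moonen, Yu. Zarhin,
Math. Ann. 315 (1999) §1: «`Hg(X)` is a connected reductive algebraic group»; J. E. Humphreys, GTM 9, §19.1:
«reductive: `L = Z(L) ⊕ [L, L]`, `[L, L]` semisimple».

THIS FILE (`H` a polarizable `ℚ`-Hodge structure of weight `n` on a finite-dimensional `V`, `𝔥 = hodgeLie H`,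
`𝔥_ℂ = hodgeLieC H ⊆ End_ℂ(V_ℂ)`; Lie subalgebras of `End` carry Mathlib's commutator bracket
`LieRing.ofAssociativeRing` — a non-instance `def` in Mathlib, supplied here by a `letI` in each statement, i.e. the same
structure Mathlib enables file-locally in `Mathlib.Algebra.Lie.CartanCriterion`):
* §1 `exists_isCompl_of_hodgeLieC_stable` (any weight) — COMPLETE REDUCIBILITY: every `𝔥_ℂ`-stable subspace `U ⊆ V_ℂ`
  has an `𝔥_ℂ`-stable complement (its Hodge-form orthogonal, transported to `EuclideanSpace ℂ`; extracted from the proof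
  of the tree's `eq_bot_or_forall_mem_of_hodgeLieC_stable`).
* §2 `exists_lieSubalgebra_eq_hodgeLieC`, and for EVERY Lie subalgebra `𝔏 ≤ 𝔤𝔩(V_ℂ)` with carrier `𝔥_ℂ`:
  `complementedLattice_lieSubmodule_of_eq_hodgeLieC` (`V_ℂ` is a completely reducible `𝔏`-module) and
  **`hasCentralRadical_of_eq_hodgeLieC`** — `rad 𝔏 = Z(𝔏)`: **`𝔥_ℂ` IS REDUCTIVE** (Mathlib `LieAlgebra.HasCentralRadical`).
* §3 DESCENT TO `ℚ` (any weight): **`le_inf_endAlg_of_abelian_ideal`** — every abelian ideal `𝔞` of `𝔥` (a `ℚ`-subspace with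
  `[𝔥, 𝔞] ⊆ 𝔞`, `[𝔞, 𝔞] = 0`) lies in the centre `𝔥 ∩ End_Hdg(V)` (its complex span is an abelian ideal of `𝔏`, hence
  central, so its elements commute with `𝔥`).
* §4 EFFECTIVE WEIGHT ONE (`H¹` of an abelian variety; `𝔥 = 𝔷 ⊕ 𝔡` from `HodgeThetaSubalgebraReductive`):
  **`hodgeLie_derived_abelian_ideal_eq_bot`** — `𝔡 = [𝔥, 𝔥]` has NO non-zero abelian ideal; `exists_lieSubalgebra_eq_hodgeLie_derived`;
  and for every Lie subalgebra `𝔏 ≤ 𝔤𝔩(V)` over `ℚ` with carrier `𝔡`: **`hasTrivialRadical_of_eq_hodgeLie_derived`**,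
  **`isSemisimple_of_eq_hodgeLie_derived`** (Mathlib `LieAlgebra.IsSemisimple`, via Cartan's criterion) — «`[Lie Hg, Lie Hg]`
  is semisimple», i.e. together with `hodgeLie_center_sup_derived_eq`: **`Lie Hg(H¹)` is reductive**.

What is NOT here: algebraic groups; `Hg` itself; abelian varieties (the CorCM layer instantiates `H = H¹(X)`).
-/

noncomputable section

open scoped TensorProduct InnerProductSpace
open Complex

namespace Literature.AlgebraicGeometry.Motives

namespace HodgeStructure

universe u

variable {V : Type u} [AddCommGroup V] [Module ℚ V] [Module.Finite ℚ V] [HodgeTensorFacts.{u, u}]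
  {n : ℤ}

/-! ### §1 Complete reducibility of `V_ℂ` under `𝔥_ℂ` -/

/-- **Every `𝔥_ℂ`-stable subspace of `V_ℂ` has an `𝔥_ℂ`-stable complement** (`H` polarizable, any weight): the
orthogonal `U^⊥` for the positive definite Hodge form `h(x, y) = ψ_ℂ(C x, conj y)` is `𝔥_ℂ`-stable because `𝔥_ℂ` is
closed under `h`-adjoints (`exists_adjoint_mem_hodgeLieC`), and `V_ℂ = U ⊕ U^⊥` (transport to `EuclideanSpace ℂ` along
an `h`-orthonormal graded basis). This is the complete reducibility behind «`MT(V,h)` is reductive» (Deligne I 3.6).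
[cite: Deligne1982HodgeCycles, I §3 Prop. 3.6] [cite: Zarhin1983HodgeGroupsK3, §2] -/
theorem exists_isCompl_of_hodgeLieC_stable (H : HodgeStructure V n) (ψ : H.Polarization)
    {U : Submodule ℂ (ℂ ⊗[ℚ] V)} (hU : ∀ Y ∈ H.hodgeLieC, ∀ x ∈ U, Y x ∈ U) :
    ∃ U' : Submodule ℂ (ℂ ⊗[ℚ] V), IsCompl U U' ∧ ∀ Y ∈ H.hodgeLieC, ∀ y ∈ U', Y y ∈ U' := by
  classical
  obtain ⟨C, hC, -⟩ := exists_weilOperator H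
  obtain ⟨S, _, _, deg, e, hF, hFc, -, horth⟩ := ψ.exists_orthonormal_graded_basis
  have hsum := form_weil_conj_eq_sum ψ e hF hFc horth hC
  -- transport to `EuclideanSpace ℂ S` along the coordinates of `e`
  let φ : (ℂ ⊗[ℚ] V) ≃ₗ[ℂ] EuclideanSpace ℂ S :=
    e.equivFun.trans (WithLp.linearEquiv 2 ℂ (S → ℂ)).symm
  have hφ : ∀ x y : ℂ ⊗[ℚ] V,
      ⟪φ x, φ y⟫_ℂ = starRingEnd ℂ (ψ.form.baseChange ℂ (C x) (conj y)) := by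
    intro x y
    rw [hsum, map_sum]
    change ⟪WithLp.toLp 2 (e.equivFun x), WithLp.toLp 2 (e.equivFun y)⟫_ℂ = _
    rw [EuclideanSpace.inner_toLp_toLp, dotProduct]
    refine Finset.sum_congr rfl fun σ _ => ?_
    rw [Module.Basis.equivFun_apply, Module.Basis.equivFun_apply, map_mul, starRingEnd_self_apply,
      mul_comm]
    rfl
  -- the `h`-orthogonal complement of `U`
  let Uφ : Submodule ℂ (EuclideanSpace ℂ S) := U.map (φ : (ℂ ⊗[ℚ] V) →ₗ[ℂ] EuclideanSpace ℂ S)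
  let Uo : Submodule ℂ (ℂ ⊗[ℚ] V) := Uφᗮ.comap (φ : (ℂ ⊗[ℚ] V) →ₗ[ℂ] EuclideanSpace ℂ S)
  have hUo : ∀ y, y ∈ Uo ↔ ∀ x ∈ U, ψ.form.baseChange ℂ (C x) (conj y) = 0 := by
    intro y
    change φ y ∈ Uφᗮ ↔ _
    rw [Submodule.mem_orthogonal]
    constructor
    · intro h x hx
      have := h (φ x) ⟨x, hx, rfl⟩
      rw [hφ, map_eq_zero] at this
      exact this
    · rintro h _ ⟨x, hx, rfl⟩
      change ⟪φ x, φ y⟫_ℂ = 0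
      rw [hφ, h x hx, map_zero]
  -- `U^⊥` is `𝔥_ℂ`-stable (adjoints stay in `𝔥_ℂ`)
  have hUo_stab : ∀ Y ∈ H.hodgeLieC, ∀ y ∈ Uo, Y y ∈ Uo := by
    intro Y hY y hy
    obtain ⟨Y', hY', hadj⟩ := exists_adjoint_mem_hodgeLieC ψ hC hY
    rw [hUo] at hy ⊢
    intro x hx
    rw [← hadj, hy _ (hU Y' hY' x hx)]
  -- `V_ℂ = U ⊕ U^⊥`
  have hcompl : IsCompl U Uo := by
    haveI : CompleteSpace Uφ := FiniteDimensional.complete ℂ Uφ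
    have hc : IsCompl Uφ Uφᗮ := Uφ.isCompl_orthogonal
    refine ⟨Submodule.disjoint_def.2 fun x hxU hxo => ?_, codisjoint_iff.2 (eq_top_iff.2 fun x _ => ?_)⟩
    · have h1 : φ x ∈ Uφ ⊓ Uφᗮ := ⟨⟨x, hxU, rfl⟩, hxo⟩
      rw [hc.inf_eq_bot, Submodule.mem_bot] at h1
      exact φ.injective (h1.trans (map_zero φ).symm)
    · have h2 : φ x ∈ Uφ ⊔ Uφᗮ := hc.sup_eq_top ▸ Submodule.mem_top
      obtain ⟨a, ha, b, hb, hab⟩ := Submodule.mem_sup.1 h2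
      obtain ⟨a', ha', rfl⟩ := ha
      refine Submodule.mem_sup.2 ⟨a', ha', φ.symm b, ?_, ?_⟩
      · change φ (φ.symm b) ∈ Uφᗮ
        rwa [φ.apply_symm_apply]
      · apply φ.injective
        rw [map_add, φ.apply_symm_apply]
        exact hab
  exact ⟨Uo, hcompl, hUo_stab⟩

/-! ### §2 `𝔥_ℂ` as a Lie subalgebra of `𝔤𝔩(V_ℂ)`: complete reducibility and central radical -/

/-- `𝔥_ℂ` is (the carrier of) a Lie subalgebra of `𝔤𝔩(V_ℂ)` for the commutator bracket — it is bracket-closed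
(`commutator_mem_hodgeLieC`). Stated as an existence so that no notion is introduced; all results below hold for EVERY
Lie subalgebra with this carrier. [cite: Deligne1982HodgeCycles, I §3 Prop. 3.4] -/
theorem exists_lieSubalgebra_eq_hodgeLieC (H : HodgeStructure V n) :
    letI : LieRing (Module.End ℂ (ℂ ⊗[ℚ] V)) := LieRing.ofAssociativeRing
    ∃ 𝔏 : LieSubalgebra ℂ (Module.End ℂ (ℂ ⊗[ℚ] V)), 𝔏.toSubmodule = H.hodgeLieC := by
  letI : LieRing (Module.End ℂ (ℂ ⊗[ℚ] V)) := LieRing.ofAssociativeRing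
  exact ⟨{ H.hodgeLieC with
      lie_mem' := fun {Y Z} hY hZ => by
        rw [LieRing.of_associative_ring_bracket]
        exact H.commutator_mem_hodgeLieC hY hZ }, rfl⟩

/-- **`V_ℂ` is a completely reducible `𝔥_ℂ`-module**: for a Lie subalgebra `𝔏 ≤ 𝔤𝔩(V_ℂ)` with carrier `𝔥_ℂ`, every
Lie `𝔏`-submodule of `V_ℂ` has a complement (`exists_isCompl_of_hodgeLieC_stable`). [cite: Deligne1982HodgeCycles, I §3 Prop. 3.6] -/
theorem complementedLattice_lieSubmodule_of_eq_hodgeLieC (H : HodgeStructure V n) (ψ : H.Polarization) :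
    letI : LieRing (Module.End ℂ (ℂ ⊗[ℚ] V)) := LieRing.ofAssociativeRing
    ∀ (𝔏 : LieSubalgebra ℂ (Module.End ℂ (ℂ ⊗[ℚ] V))), 𝔏.toSubmodule = H.hodgeLieC →
      ComplementedLattice (LieSubmodule ℂ 𝔏 (ℂ ⊗[ℚ] V)) := by
  letI : LieRing (Module.End ℂ (ℂ ⊗[ℚ] V)) := LieRing.ofAssociativeRing
  intro 𝔏 h𝔏
  refine ⟨fun N => ?_⟩
  have hmem : ∀ Y : Module.End ℂ (ℂ ⊗[ℚ] V), Y ∈ H.hodgeLieC ↔ Y ∈ 𝔏 := fun Y => by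
    rw [← LieSubalgebra.mem_toSubmodule, h𝔏]
  have hN : ∀ Y ∈ H.hodgeLieC, ∀ x ∈ (N : Submodule ℂ (ℂ ⊗[ℚ] V)), Y x ∈ (N : Submodule ℂ (ℂ ⊗[ℚ] V)) := by
    intro Y hY x hx
    have h := N.lie_mem (x := ⟨Y, (hmem Y).1 hY⟩) hx
    rwa [LieSubalgebra.coe_bracket_of_module, Module.End.lie_apply] at h
  obtain ⟨U', hc, hU'⟩ := exists_isCompl_of_hodgeLieC_stable H ψ hN
  let N' : LieSubmodule ℂ 𝔏 (ℂ ⊗[ℚ] V) :=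
    { U' with
      lie_mem := fun {Y x} hx => by
        rw [LieSubalgebra.coe_bracket_of_module, Module.End.lie_apply]
        exact hU' _ ((hmem _).2 Y.2) x hx }
  refine ⟨N', ?_⟩
  rw [← LieSubmodule.isCompl_toSubmodule]
  exact hc

/-- **`𝔥_ℂ` is reductive: its radical is its centre** (`LieAlgebra.HasCentralRadical ℂ 𝔏` for every Lie subalgebra
`𝔏 ≤ 𝔤𝔩(V_ℂ)` with carrier `𝔥_ℂ`; `H` polarizable, any weight). `V_ℂ` is a faithful, completely reducible,
triangularizable `𝔏`-module, so Lie's theorem makes the radical central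
(`Literature.Algebra.Lie.hasCentralRadical_of_complementedLattice`). Deligne I 3.6: «`MT(V, h)` est réductif».
[cite: Deligne1982HodgeCycles, I §3 Prop. 3.6] [cite: MoonenZarhin1999LowDim, §1] -/
theorem hasCentralRadical_of_eq_hodgeLieC (H : HodgeStructure V n) (ψ : H.Polarization) :
    letI : LieRing (Module.End ℂ (ℂ ⊗[ℚ] V)) := LieRing.ofAssociativeRing
    ∀ (𝔏 : LieSubalgebra ℂ (Module.End ℂ (ℂ ⊗[ℚ] V))), 𝔏.toSubmodule = H.hodgeLieC →
      LieAlgebra.HasCentralRadical ℂ 𝔏 := by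
  letI : LieRing (Module.End ℂ (ℂ ⊗[ℚ] V)) := LieRing.ofAssociativeRing
  intro 𝔏 h𝔏
  haveI := complementedLattice_lieSubmodule_of_eq_hodgeLieC H ψ 𝔏 h𝔏
  haveI : Module.Finite ℂ 𝔏 := Module.Finite.of_injective 𝔏.toSubmodule.subtype Subtype.val_injective
  exact Literature.Algebra.Lie.hasCentralRadical_of_complementedLattice (k := ℂ) (L := 𝔏) (M := ℂ ⊗[ℚ] V)

/-! ### §3 Descent: abelian ideals of `𝔥` are central -/

/-- **Every abelian ideal of `𝔥 = Lie Hg(H)` lies in the centre `𝔥 ∩ End_Hdg(V)`** (`H` polarizable, any weight). For a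
`ℚ`-subspace `𝔞 ≤ 𝔥` with `[𝔥, 𝔞] ⊆ 𝔞` and `[𝔞, 𝔞] = 0`: the `ℂ`-span of the `a_ℂ`, `a ∈ 𝔞`, is an abelian — hence
solvable — ideal of a Lie subalgebra `𝔏` with carrier `𝔥_ℂ`, so it lies in `rad 𝔏 = Z(𝔏)` (`hasCentralRadical_of_eq_hodgeLieC`);
thus each `a ∈ 𝔞` commutes with all `X_ℂ`, `X ∈ 𝔥`, i.e. with `𝔥`, and is a Hodge endomorphism
(`hodgeLie_center_eq_inf_endAlg`). [cite: Deligne1982HodgeCycles, I §3 Prop. 3.6] [cite: MoonenZarhin1999LowDim, §1] -/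
theorem le_inf_endAlg_of_abelian_ideal (H : HodgeStructure V n) (ψ : H.Polarization)
    {𝔞 : Submodule ℚ (Module.End ℚ V)} (h𝔞 : 𝔞 ≤ H.hodgeLie)
    (hideal : ∀ X ∈ H.hodgeLie, ∀ A ∈ 𝔞, X * A - A * X ∈ 𝔞) (hab : ∀ A ∈ 𝔞, ∀ B ∈ 𝔞, A * B = B * A) :
    𝔞 ≤ H.hodgeLie ⊓ Subalgebra.toSubmodule H.endAlg := by
  classical
  letI : LieRing (Module.End ℂ (ℂ ⊗[ℚ] V)) := LieRing.ofAssociativeRing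
  obtain ⟨𝔏, h𝔏⟩ := exists_lieSubalgebra_eq_hodgeLieC H
  haveI := hasCentralRadical_of_eq_hodgeLieC H ψ 𝔏 h𝔏
  have hmem : ∀ Y : Module.End ℂ (ℂ ⊗[ℚ] V), Y ∈ H.hodgeLieC ↔ Y ∈ 𝔏 := fun Y => by
    rw [← LieSubalgebra.mem_toSubmodule, h𝔏]
  -- the complex span of `𝔞` inside `𝔏`, as a Lie ideal
  let 𝔞c : Submodule ℂ (Module.End ℂ (ℂ ⊗[ℚ] V)) := spanC 𝔞
  have h𝔞c_le : 𝔞c ≤ H.hodgeLieC := by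
    change spanC 𝔞 ≤ spanC H.hodgeLie
    exact Submodule.span_mono (Set.image_mono h𝔞)
  -- `[𝔥_ℂ, 𝔞_ℂ] ⊆ 𝔞_ℂ`
  have hideal_c : ∀ Y ∈ H.hodgeLieC, ∀ A ∈ 𝔞c, Y * A - A * Y ∈ 𝔞c := by
    intro Y hY A hA
    induction hY using Submodule.span_induction generalizing A with
    | mem Z hZ =>
      obtain ⟨X, hX, rfl⟩ := hZ
      induction hA using Submodule.span_induction with
      | mem B hB =>
        obtain ⟨A₀, hA₀, rfl⟩ := hB
        rw [← LinearMap.baseChange_mul, ← LinearMap.baseChange_mul, ← LinearMap.baseChange_sub]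
        exact baseChange_mem_spanC (hideal X hX A₀ hA₀)
      | zero => rw [mul_zero, zero_mul, sub_self]; exact Submodule.zero_mem _
      | add B B' _ _ hB hB' =>
        rw [mul_add, add_mul, add_sub_add_comm]; exact Submodule.add_mem _ hB hB'
      | smul c B _ hB => rw [mul_smul_comm, smul_mul_assoc, ← smul_sub]; exact Submodule.smul_mem _ c hB
    | zero => rw [zero_mul, mul_zero, sub_self]; exact Submodule.zero_mem _
    | add Z Z' _ _ hZ hZ' =>
      rw [add_mul, mul_add, add_sub_add_comm]; exact Submodule.add_mem _ (hZ A hA) (hZ' A hA)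
    | smul c Z _ hZ => rw [smul_mul_assoc, mul_smul_comm, ← smul_sub]; exact Submodule.smul_mem _ c (hZ A hA)
  -- `[𝔞_ℂ, 𝔞_ℂ] = 0`
  have hab_c : ∀ A ∈ 𝔞c, ∀ B ∈ 𝔞c, A * B = B * A := by
    intro A hA B hB
    refine commute_of_mem_spanC (fun A₀ hA₀ => ?_) hA |>.symm
    refine (commute_of_mem_spanC (fun B₀ hB₀ => ?_) hB).symm
    rw [← LinearMap.baseChange_mul, ← LinearMap.baseChange_mul, hab A₀ hA₀ B₀ hB₀]
  -- the Lie ideal `I` of `𝔏` with carrier `𝔞_ℂ`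
  let I : LieIdeal ℂ 𝔏 :=
    { (𝔞c.comap 𝔏.toSubmodule.subtype) with
      lie_mem := fun {Y A} hA => by
        change ((⁅Y, A⁆ : 𝔏) : Module.End ℂ (ℂ ⊗[ℚ] V)) ∈ 𝔞c
        rw [LieSubalgebra.coe_bracket, LieRing.of_associative_ring_bracket]
        exact hideal_c _ ((hmem _).2 Y.2) _ hA }
  have hImem : ∀ A : 𝔏, A ∈ I ↔ (A : Module.End ℂ (ℂ ⊗[ℚ] V)) ∈ 𝔞c := fun A => Iff.rfl
  -- `I` is abelian, hence solvable, hence central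
  haveI : IsLieAbelian I :=
    ⟨fun A B => Subtype.ext (Subtype.ext (by
      rw [LieIdeal.coe_bracket_of_module, LieSubmodule.coe_bracket, ZeroMemClass.coe_zero, ZeroMemClass.coe_zero,
        LieSubalgebra.coe_bracket, LieRing.of_associative_ring_bracket, sub_eq_zero]
      exact hab_c _ ((hImem _).1 A.2) _ ((hImem _).1 B.2)))⟩
  have hIcent : I ≤ LieAlgebra.center ℂ 𝔏 := by
    rw [← LieAlgebra.radical_eq_center]
    exact (LieAlgebra.LieIdeal.solvable_iff_le_radical (R := ℂ) (L := 𝔏) I).1 inferInstance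
  -- conclusion for `a ∈ 𝔞`
  intro a ha
  have haH : a ∈ H.hodgeLie := h𝔞 ha
  have hac : a.baseChange ℂ ∈ 𝔞c := baseChange_mem_spanC ha
  have ha𝔏 : a.baseChange ℂ ∈ 𝔏 := (hmem _).1 (h𝔞c_le hac)
  have hcent := hIcent ((hImem ⟨a.baseChange ℂ, ha𝔏⟩).2 hac)
  rw [LieAlgebra.center, LieModule.mem_maxTrivSubmodule] at hcent
  rw [← hodgeLie_center_eq_inf_endAlg, Literature.Algebra.Lie.TraceSeparating.mem_center_iff]
  refine ⟨haH, fun Y hY => ?_⟩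
  have hYc : Y.baseChange ℂ ∈ 𝔏 := (hmem _).1 (H.baseChange_mem_hodgeLieC hY)
  have h0 := hcent ⟨Y.baseChange ℂ, hYc⟩
  have h1 : Y.baseChange ℂ * a.baseChange ℂ - a.baseChange ℂ * Y.baseChange ℂ = 0 := by
    have := congrArg (fun Z : 𝔏 => (Z : Module.End ℂ (ℂ ⊗[ℚ] V))) h0
    simpa [LieSubalgebra.coe_bracket, LieRing.of_associative_ring_bracket] using this
  rw [← LinearMap.baseChange_mul, ← LinearMap.baseChange_mul, ← LinearMap.baseChange_sub] at h1
  have h2 : Y * a - a * Y = 0 := by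
    have hmem0 : Y * a - a * Y ∈ (⊥ : Submodule ℚ (Module.End ℚ V)) :=
      mem_of_baseChange_mem_spanC ⊥ (by rw [h1]; exact Submodule.zero_mem _)
    exact (Submodule.mem_bot ℚ).1 hmem0
  exact (sub_eq_zero.1 h2).symm

/-! ### §4 Effective weight one: `[𝔥, 𝔥]` is semisimple -/

/-- **`𝔡 = [Lie Hg, Lie Hg]` has no non-zero abelian ideal** (effective weight one, `H` polarized): an abelian ideal `𝔞`
of `𝔡` is an abelian ideal of `𝔥 = 𝔷 ⊕ 𝔡` (`𝔷` is central), hence `𝔞 ⊆ 𝔷` (`le_inf_endAlg_of_abelian_ideal`), hence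
`𝔞 ⊆ 𝔷 ∩ 𝔡 = 0` (`hodgeLie_center_inf_derived_eq_bot`). [cite: Deligne1982HodgeCycles, I §3 Prop. 3.6]
[cite: Humphreys1972, §19.1] -/
theorem hodgeLie_derived_abelian_ideal_eq_bot (H : HodgeStructure V n) (hn : n = 1) (heff : H.IsEffective)
    (ψ : H.Polarization) {𝔞 : Submodule ℚ (Module.End ℚ V)}
    (h𝔞 : 𝔞 ≤ Submodule.span ℚ {B | ∃ X ∈ H.hodgeLie, ∃ Y ∈ H.hodgeLie, X * Y - Y * X = B})
    (hideal : ∀ D ∈ Submodule.span ℚ {B | ∃ X ∈ H.hodgeLie, ∃ Y ∈ H.hodgeLie, X * Y - Y * X = B},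
      ∀ A ∈ 𝔞, D * A - A * D ∈ 𝔞)
    (hab : ∀ A ∈ 𝔞, ∀ B ∈ 𝔞, A * B = B * A) : 𝔞 = ⊥ := by
  obtain ⟨hbr, hskew, hcomm, Θ, hΘ, hΘ𝔤⟩ := hodgeLie_standing H ψ
  have h𝔡le : Submodule.span ℚ {B | ∃ X ∈ H.hodgeLie, ∃ Y ∈ H.hodgeLie, X * Y - Y * X = B} ≤ H.hodgeLie :=
    Literature.Algebra.Lie.TraceSeparating.derived_le H.hodgeLie hbr
  -- `𝔞` is an ideal of `𝔥 = 𝔷 + 𝔡`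
  have hideal' : ∀ X ∈ H.hodgeLie, ∀ A ∈ 𝔞, X * A - A * X ∈ 𝔞 := by
    intro X hX A hA
    have hX' : X ∈ H.hodgeLie ⊓ Subalgebra.toSubmodule H.endAlg ⊔
        Submodule.span ℚ {B | ∃ X ∈ H.hodgeLie, ∃ Y ∈ H.hodgeLie, X * Y - Y * X = B} := by
      rw [hodgeLie_center_sup_derived_eq H hn heff ψ]; exact hX
    obtain ⟨Z, hZ, D, hD, rfl⟩ := Submodule.mem_sup.1 hX'
    rw [← hodgeLie_center_eq_inf_endAlg, Literature.Algebra.Lie.TraceSeparating.mem_center_iff] at hZ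
    have hZA : Z * A = A * Z := hZ.2 A (h𝔡le (h𝔞 hA))
    rw [add_mul, mul_add, hZA, add_sub_add_comm, sub_self, zero_add]
    exact hideal D hD A hA
  have hcent := le_inf_endAlg_of_abelian_ideal H ψ (h𝔞.trans h𝔡le) hideal' hab
  rw [eq_bot_iff]
  intro A hA
  have h := Submodule.mem_inf.2 ⟨hcent hA, h𝔞 hA⟩
  rwa [hodgeLie_center_inf_derived_eq_bot H ψ] at h

/-- `𝔡 = [Lie Hg, Lie Hg]` is (the carrier of) a Lie subalgebra of `𝔤𝔩(V)` over `ℚ` (it contains `[𝔥, 𝔥] ⊇ [𝔡, 𝔡]`).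
[cite: Humphreys1972, §19.1] -/
theorem exists_lieSubalgebra_eq_hodgeLie_derived (H : HodgeStructure V n) :
    letI : LieRing (Module.End ℚ V) := LieRing.ofAssociativeRing
    ∃ 𝔏 : LieSubalgebra ℚ (Module.End ℚ V),
      𝔏.toSubmodule = Submodule.span ℚ {B | ∃ X ∈ H.hodgeLie, ∃ Y ∈ H.hodgeLie, X * Y - Y * X = B} := by
  letI : LieRing (Module.End ℚ V) := LieRing.ofAssociativeRing
  have h𝔡le : Submodule.span ℚ {B | ∃ X ∈ H.hodgeLie, ∃ Y ∈ H.hodgeLie, X * Y - Y * X = B} ≤ H.hodgeLie :=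
    Literature.Algebra.Lie.TraceSeparating.derived_le H.hodgeLie fun X hX Y hY => H.commutator_mem_hodgeLie hX hY
  exact ⟨{ Submodule.span ℚ {B | ∃ X ∈ H.hodgeLie, ∃ Y ∈ H.hodgeLie, X * Y - Y * X = B} with
      lie_mem' := fun {X Y} hX hY => by
        rw [LieRing.of_associative_ring_bracket]
        exact Literature.Algebra.Lie.TraceSeparating.commutator_mem_derived H.hodgeLie (h𝔡le hX) (h𝔡le hY) }, rfl⟩

/-- **`[Lie Hg, Lie Hg]` is semisimple, I: trivial radical** — for every Lie subalgebra `𝔏 ≤ 𝔤𝔩(V)` over `ℚ` with carrier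
`𝔡 = [𝔥, 𝔥]` (effective weight one, `H` polarized), `rad 𝔏 = 0` (Mathlib `LieAlgebra.HasTrivialRadical`): an abelian Lie
ideal of `𝔏` is an abelian ideal of `𝔡` in the sense of `hodgeLie_derived_abelian_ideal_eq_bot`.
[cite: Deligne1982HodgeCycles, I §3 Prop. 3.6] [cite: Humphreys1972, §19.1] -/
theorem hasTrivialRadical_of_eq_hodgeLie_derived (H : HodgeStructure V n) (hn : n = 1) (heff : H.IsEffective)
    (ψ : H.Polarization) :
    letI : LieRing (Module.End ℚ V) := LieRing.ofAssociativeRing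
    ∀ (𝔏 : LieSubalgebra ℚ (Module.End ℚ V)),
      𝔏.toSubmodule = Submodule.span ℚ {B | ∃ X ∈ H.hodgeLie, ∃ Y ∈ H.hodgeLie, X * Y - Y * X = B} →
      LieAlgebra.HasTrivialRadical ℚ 𝔏 := by
  letI : LieRing (Module.End ℚ V) := LieRing.ofAssociativeRing
  intro 𝔏 h𝔏
  rw [LieAlgebra.hasTrivialRadical_iff_no_abelian_ideals]
  intro I hI
  -- the carrier of `I` inside `End_ℚ(V)`
  let 𝔞 : Submodule ℚ (Module.End ℚ V) := I.toSubmodule.map 𝔏.toSubmodule.subtype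
  have h𝔞mem : ∀ A, A ∈ 𝔞 ↔ ∃ A' : 𝔏, A' ∈ I ∧ (A' : Module.End ℚ V) = A := fun A => by
    constructor
    · rintro ⟨A', hA', rfl⟩; exact ⟨A', hA', rfl⟩
    · rintro ⟨A', hA', rfl⟩; exact ⟨A', hA', rfl⟩
  have h𝔞le : 𝔞 ≤ Submodule.span ℚ {B | ∃ X ∈ H.hodgeLie, ∃ Y ∈ H.hodgeLie, X * Y - Y * X = B} := by
    intro A hA
    obtain ⟨A', -, rfl⟩ := (h𝔞mem A).1 hA
    rw [← h𝔏]; exact A'.2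
  have hideal : ∀ D ∈ Submodule.span ℚ {B | ∃ X ∈ H.hodgeLie, ∃ Y ∈ H.hodgeLie, X * Y - Y * X = B},
      ∀ A ∈ 𝔞, D * A - A * D ∈ 𝔞 := by
    intro D hD A hA
    obtain ⟨A', hA', rfl⟩ := (h𝔞mem A).1 hA
    have hD𝔏 : D ∈ 𝔏 := by rw [← LieSubalgebra.mem_toSubmodule, h𝔏]; exact hD
    refine (h𝔞mem _).2 ⟨⁅(⟨D, hD𝔏⟩ : 𝔏), A'⁆, I.lie_mem hA', ?_⟩
    rw [LieSubalgebra.coe_bracket, LieRing.of_associative_ring_bracket]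
  have hab : ∀ A ∈ 𝔞, ∀ B ∈ 𝔞, A * B = B * A := by
    intro A hA B hB
    obtain ⟨A', hA', rfl⟩ := (h𝔞mem A).1 hA
    obtain ⟨B', hB', rfl⟩ := (h𝔞mem B).1 hB
    have h0 : ⁅(⟨A', hA'⟩ : I), (⟨B', hB'⟩ : I)⁆ = 0 := hI.trivial _ _
    have h1 := congrArg (fun Z : I => ((Z : 𝔏) : Module.End ℚ V)) h0
    simp only [LieIdeal.coe_bracket_of_module, LieSubmodule.coe_bracket, ZeroMemClass.coe_zero,
      LieSubalgebra.coe_bracket, LieRing.of_associative_ring_bracket] at h1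
    exact sub_eq_zero.1 h1
  have h𝔞0 := hodgeLie_derived_abelian_ideal_eq_bot H hn heff ψ h𝔞le hideal hab
  rw [eq_bot_iff]
  intro A' hA'
  have : (A' : Module.End ℚ V) ∈ 𝔞 := (h𝔞mem _).2 ⟨A', hA', rfl⟩
  rw [h𝔞0, Submodule.mem_bot] at this
  rw [LieSubmodule.mem_bot]
  exact Subtype.ext this

/-- **`[Lie Hg, Lie Hg]` is semisimple, II** — `LieAlgebra.IsSemisimple ℚ 𝔏` for every Lie subalgebra `𝔏 ≤ 𝔤𝔩(V)` with
carrier `𝔡 = [𝔥, 𝔥]` (effective weight one, `H` polarized): trivial radical plus Cartan's criterion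
(`LieAlgebra.HasTrivialRadical.instIsKilling`, `LieAlgebra.IsKilling.instSemisimple`). With
`hodgeLie_center_sup_derived_eq` («`𝔥 = 𝔷 ⊕ 𝔡`») this is «`Lie Hg(H¹)` is reductive» (Deligne I 3.6; Moonen–Zarhin §1;
Humphreys §19.1) in Mathlib's vocabulary. [cite: Deligne1982HodgeCycles, I §3 Prop. 3.6]
[cite: MoonenZarhin1999LowDim, §1] [cite: Humphreys1972, §19.1] -/
theorem isSemisimple_of_eq_hodgeLie_derived (H : HodgeStructure V n) (hn : n = 1) (heff : H.IsEffective)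
    (ψ : H.Polarization) :
    letI : LieRing (Module.End ℚ V) := LieRing.ofAssociativeRing
    ∀ (𝔏 : LieSubalgebra ℚ (Module.End ℚ V)),
      𝔏.toSubmodule = Submodule.span ℚ {B | ∃ X ∈ H.hodgeLie, ∃ Y ∈ H.hodgeLie, X * Y - Y * X = B} →
      LieAlgebra.IsSemisimple ℚ 𝔏 := by
  letI : LieRing (Module.End ℚ V) := LieRing.ofAssociativeRing
  intro 𝔏 h𝔏
  haveI := hasTrivialRadical_of_eq_hodgeLie_derived H hn heff ψ 𝔏 h𝔏
  haveI : Module.Finite ℚ 𝔏 := Module.Finite.of_injective 𝔏.toSubmodule.subtype Subtype.val_injective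
  haveI : LieAlgebra.IsKilling ℚ 𝔏 := LieAlgebra.HasTrivialRadical.instIsKilling ℚ 𝔏
  exact LieAlgebra.IsKilling.instSemisimple ℚ 𝔏

/-- **The Killing form of `[Lie Hg, Lie Hg]` is non-degenerate** (`LieAlgebra.IsKilling`, Cartan's criterion; effective
weight one) — the hypothesis of Mathlib's root-space theory (`LieAlgebra.IsKilling.rootSystem`).
[cite: Humphreys1972, §5.1] [cite: Deligne1982HodgeCycles, I §3 Prop. 3.6] -/
theorem isKilling_of_eq_hodgeLie_derived (H : HodgeStructure V n) (hn : n = 1) (heff : H.IsEffective)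
    (ψ : H.Polarization) :
    letI : LieRing (Module.End ℚ V) := LieRing.ofAssociativeRing
    ∀ (𝔏 : LieSubalgebra ℚ (Module.End ℚ V)),
      𝔏.toSubmodule = Submodule.span ℚ {B | ∃ X ∈ H.hodgeLie, ∃ Y ∈ H.hodgeLie, X * Y - Y * X = B} →
      LieAlgebra.IsKilling ℚ 𝔏 := by
  letI : LieRing (Module.End ℚ V) := LieRing.ofAssociativeRing
  intro 𝔏 h𝔏
  haveI := hasTrivialRadical_of_eq_hodgeLie_derived H hn heff ψ 𝔏 h𝔏
  haveI : Module.Finite ℚ 𝔏 := Module.Finite.of_injective 𝔏.toSubmodule.subtype Subtype.val_injective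
  exact LieAlgebra.HasTrivialRadical.instIsKilling ℚ 𝔏

end HodgeStructure

end Literature.AlgebraicGeometry.Motives

end
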